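import Summits.Ventures.PercRepro.RankLevelSetExplicitLin2Bases58

/-!
# PercRepro — THE KERNEL BASES OF THE 5/8 RANGE AT LEVEL `17` (p9, S4)

`proofs/SUBCLAIM-S4-p9.md` §S4.2⁗⁗. RankLevelSetExplicitLin2Bases58 carries the levels `10 … 16`; for the level-`17` step of
`c025_level_succ_of_key_row_tailOpt58` (`q = 16`) the two regimes with the flat bound `B' = 5·2^{14} − 1` need one kernel evaluation
each: regime one at `N₁ = 82 187` and regime two at `P₂ = 81 973` (the least such bases to the unit, lane twin/range58.py;
both below the level-17 row `82 928`). Axioms: standard (kernel `decide`).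
-/

namespace PercRepro

namespace ThmN

namespace Explicit

/-- Regime one of the 5/8 range at level `17` from the base `N₁ = 82 187`: `8·18·2^{5·2^{14}−1−17}·82 187^{17} ≤ 2^{82 187}` (kernel). -/
theorem base_one58_seventeen :
    8 * (16 + 1 + 1) * 2 ^ (5 * 2 ^ (16 + 1 - 3) - 1 - (16 + 1)) * 82187 ^ (16 + 1) ≤ 2 ^ 82187 := by
  decide +kernel

/-- Regime two of the 5/8 range at level `17` from the base `P₂ = 81 973`:
`2^{81 973+17}·2^{5·2^{14}−1−17}·(2(81 973−1−17)+1) ≤ 4^{81 973−1−17}` (kernel). -/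
theorem base_two58_seventeen :
    2 ^ (81973 + (16 + 1)) * 2 ^ (5 * 2 ^ (16 + 1 - 3) - 1 - (16 + 1)) * (2 * (81973 - 1 - (16 + 1)) + 1) ≤
      4 ^ (81973 - 1 - (16 + 1)) := by
  decide +kernel

end Explicit

end ThmN

end PercRepro
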